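import Literature.AlgebraicGeometry.AbelianSchemes.AbelianSchemeDualTransportOfBaseChangeAnyBase
import Literature.AlgebraicGeometry.AbelianSchemes.AbelianSchemeDualPairNormalize
import Literature.AlgebraicGeometry.AbelianSchemes.PolarizedAbelianSchemeWithLevelBaseChangeCancel
import Literature.AlgebraicGeometry.AbelianSchemes.AbelianSchemeOverGlueData
import HarnessLib

/-!
# Zariski gluing of dual pairs, FILE H part 1: the TRANSITION ISOMORPHISMS of the chart duals over the double overlaps
# (hats of chartwise dual pairs as the data of a `CocycleDatum` over `𝒰.gluedCover`; `θᵢᵢ = 𝟙`)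

Layer `Literature/AlgebraicGeometry/AbelianSchemes`, namespace `Literature.AlgebraicGeometry.AbelianSchemes.AbelianSchemeOver`.
Cell hodgecm-mathlib (D-0151), FLOOR 0 programme P1, sub-line `Cruxes/HDel/Lines/F3DualAbelianScheme.lean` (17224f58), stub (Z)
`stub_F3Z` «`DualPair`s GLUE ALONG A ZARISKI COVER OF THE BASE» (hand of record: B-p06 lineage), road (Z3) FILE H of
`B-provers/B-p06/g14/F3/SOCKETS-F3Z-Z1-Z3.B-p06g14.md` (b2336dc7), steps (H1)–(H3).  Two definitions with bodies (the family
transition `overlapTransition` and the hat transition `hatTransition`, both `choose`/composites of ★ constructions), theorems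
otherwise; no structure, no named fact, no instance, no notation, no `sorry`.

SETTING ([MumfordFogartyKirwan1994, Ch. 6 §1 Cor. 6.8]; [BoschLutkebohmertRaynaud1990] §8.1: the rigidified Picard functor is a
Zariski sheaf).  `A → S` an abelian scheme over a LOCALLY NOETHERIAN base `S`, `𝒰 = (Uᵢ → S)` an open cover (Mathlib
`Scheme.OpenCover`), and on every chart a dual pair `Dᵢ` of `Aᵢ := A ×_S Uᵢ` (★ `DualPair`, [MilneAV2008, I §8]).  Write
`V(i,j) := Uᵢ ×_S Uⱼ` (= `𝒰.gluedCover.V (i,j)`, Mathlib `Scheme.Cover.gluedCover`) and `Aᵢ|_{V(i,j)} := Aᵢ ×_{Uᵢ} V(i,j)`.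

* §1 `overlapFamily i j := Aᵢ|_{V(i,j)}`; it is a base change of `A` along `V(i,j) → S` AS A GROUP SCHEME
  (`overlapFamily_isBaseChangeVia`, ★ `baseChange_isBaseChangeVia` twice + ★ `IsBaseChangeVia.trans`), hence — squares of group
  schemes cancel, ★ `isBaseChangeVia_of_comp` — there is a transition `overlapTransition i j : Aᵢ|_{V(i,j)} → Aⱼ|_{V(j,i)}` of
  GROUP schemes covering the flip `V(i,j) ≅ V(j,i)` (= `𝒰.gluedCover.t i j`), unique (`overlapTransition_unique`), with
  `overlapTransition i i = 𝟙` (`overlapTransition_self`).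
* §2 normalise the chart duals (`chartDual i := (D i).normalize`, ★ `DualPair.normalize` — cures FINDING 8aea22b3: `𝒫ᵢ|_{Aᵢ × {ε}} ≅ 𝒪`,
  so every dual transport below is a homomorphism) and define **`hatTransition i j : Âᵢ|_{V(i,j)} → Âⱼ|_{V(j,i)}`** := ★
  `DualPair.hatTransportOfBaseChange` along the square `(overlapTransition i j, flip)` between the base-changed duals (★
  `DualPair.baseChange`); **`hatTransition_isBaseChangeVia`**: it is a base change of GROUP schemes along the flip — ★
  `hat_isBaseChangeVia_hatTransportOfBaseChange_of_isLocallyNoetherian_base` (NO connectedness; `V(i,j)` is locally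
  Noetherian as an open of `S`), i.e. exactly the `hθ` field of ★ `CocycleDatum 𝒰.gluedCover` for the hats; and the POINCARÉ
  clause `(overlapTransition × hatTransition)^* 𝒫ⱼ| ≅ 𝒫ᵢ|` (`nonempty_pullback_map_hatTransition_iso`).
* §3 **`hatTransition_self : hatTransition i i = 𝟙`** (the `hθid` field): the square `(𝟙, 𝟙)` transports by `𝟙` (uniqueness
  ★ `eq_hatTransportOfBaseChange_of_nonempty_pullback_map_iso` with `Ĝ₁ := 𝟙`).
* §4 **`hatCocycleDatum (hcoc)`** — the `CocycleDatum 𝒰.gluedCover` of the hats GIVEN the cocycle identity `hcoc` on triple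
  overlaps (road (H4) of the SOCKETS memo: ★ `AbelianSchemeOverGlueDataTripleCocycle` template with ★ `DualPair.eq_of_nonempty_iso`
  as the rigidity input — the sequel FILE H part 2), and the GLUED HAT `gluedHat hcoc : AbelianSchemeOver 𝒰.gluedCover.glued`
  (★ `CocycleDatum.abelianScheme`) with cartesian charts (★ `CocycleDatum.isBaseChangeVia_abelianScheme`).

HC_CM is proved only modulo the 7 printed citations until rung 0 closes; this file discharges none of them (count-neutral capital).

Mathlib searched (pin): `Scheme.Cover.gluedCover` (`V (i,j) = pullback (𝒰.f i) (𝒰.f j)`, `f i j = pullback.fst`, `t i j =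
(pullbackSymmetry _ _).hom`, all by `rfl`), `pullbackSymmetry_hom_comp_fst/snd`, `fst_eq_snd_of_mono_eq`,
`isLocallyNoetherian_of_isOpenImmersion`, `Scheme.Modules.pullbackId/pullbackCongr`.

## References
* [MumfordFogartyKirwan1994] D. Mumford, J. Fogarty, F. Kirwan, *Geometric Invariant Theory*, 3rd ed. (1994), Ch. 6 §1
  Cor. 6.4 (p. 117), Cor. 6.8 (p. 118); Ch. 7 §2 Def. 7.2, Def. 7.3 (p. 129), remark after Def. 7.5 (p. 130).
* [MilneAV2008] J. S. Milne, *Abelian Varieties* (v2.00, 2008), I §8 pp. 36–37 (the dual pair is unique up to a unique isomorphism).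
* [StacksProject] The Stacks Project, Tag 01LH (relative glueing), Tag 01JA (glueing schemes).
* [GortzWedhorn2020] U. Görtz, T. Wedhorn, *Algebraic Geometry I*, 2nd ed. (2020), Prop. 4.16 (p. 101), Section (4.7) (pp. 107–108).
-/

universe u

open CategoryTheory CategoryTheory.Limits AlgebraicGeometry MonoidalCategory
open Literature.AlgebraicGeometry.Morphisms

noncomputable section

namespace Literature.AlgebraicGeometry.AbelianSchemes

namespace AbelianSchemeOver

variable {S : Scheme.{u}} (A : AbelianSchemeOver S) (𝒰 : Scheme.OpenCover.{u} S)

/-! ### §1 The families over the double overlaps and their transition (squares of group schemes cancel) -/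

/-- `Aᵢ|_{V(i,j)} := (A ×_S Uᵢ) ×_{Uᵢ} V(i,j)`, the chart family restricted to the double overlap `V(i,j) = Uᵢ ×_S Uⱼ`.
[cite: MumfordFogartyKirwan1994, Ch. 7 §2 Definition 7.2 (p. 129)] -/
abbrev overlapFamily (i j : 𝒰.I₀) : AbelianSchemeOver (pullback (𝒰.f i) (𝒰.f j)) :=
  (A.baseChange (𝒰.f i)).baseChange (pullback.fst (𝒰.f i) (𝒰.f j))

/-- `Aᵢ|_{V(i,j)}` is the base change of `A` along `V(i,j) → Uᵢ → S` AS A GROUP SCHEME (two chosen base-change squares compose).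
[cite: MumfordFogartyKirwan1994, Ch. 7 §2 Definition 7.2 (p. 129)] [cite: GortzWedhorn2020, Section (4.7) (pp. 107–108)] -/
theorem overlapFamily_isBaseChangeVia (i j : 𝒰.I₀) :
    (A.overlapFamily 𝒰 i j).IsBaseChangeVia A (pullback.fst (𝒰.f i) (𝒰.f j) ≫ 𝒰.f i)
      (pullback.fst (A.baseChange (𝒰.f i)).X.hom (pullback.fst (𝒰.f i) (𝒰.f j)) ≫ pullback.fst A.X.hom (𝒰.f i)) :=
  ((A.baseChange (𝒰.f i)).baseChange_isBaseChangeVia (pullback.fst (𝒰.f i) (𝒰.f j))).trans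
    (A.baseChange_isBaseChangeVia (𝒰.f i))

/-- The base map of `Aᵢ|_{V(i,j)} → S` factors through the flip `V(i,j) ≅ V(j,i)` and `V(j,i) → Uⱼ → S`:
`pr₁ ≫ (Uᵢ → S) = flip ≫ pr₁ ≫ (Uⱼ → S)`. [cite: StacksProject, Tag 01JA] -/
theorem fst_comp_f_eq_flip_comp (i j : 𝒰.I₀) :
    pullback.fst (𝒰.f i) (𝒰.f j) ≫ 𝒰.f i =
      (pullbackSymmetry (𝒰.f i) (𝒰.f j)).hom ≫ pullback.fst (𝒰.f j) (𝒰.f i) ≫ 𝒰.f j := by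
  rw [pullbackSymmetry_hom_comp_fst_assoc]
  exact pullback.condition

/-- `Aᵢ|_{V(i,j)}` as a base change of `A` along `flip ≫ (V(j,i) → Uⱼ → S)` (transport of `overlapFamily_isBaseChangeVia` along
`fst_comp_f_eq_flip_comp`). [cite: MumfordFogartyKirwan1994, Ch. 7 §2 Definition 7.2 (p. 129)] -/
theorem overlapFamily_isBaseChangeVia_flip (i j : 𝒰.I₀) :
    (A.overlapFamily 𝒰 i j).IsBaseChangeVia A
      ((pullbackSymmetry (𝒰.f i) (𝒰.f j)).hom ≫ pullback.fst (𝒰.f j) (𝒰.f i) ≫ 𝒰.f j)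
      (pullback.fst (A.baseChange (𝒰.f i)).X.hom (pullback.fst (𝒰.f i) (𝒰.f j)) ≫ pullback.fst A.X.hom (𝒰.f i)) :=
  IsBaseChangeVia.congr_base (fst_comp_f_eq_flip_comp 𝒰 i j) (A.overlapFamily_isBaseChangeVia 𝒰 i j)

/-- **There is a transition of GROUP schemes `Aᵢ|_{V(i,j)} → Aⱼ|_{V(j,i)}` covering the flip `V(i,j) ≅ V(j,i)` and compatible
with the projections to `A`** — both families are base changes of `A` along the same map to `S`; squares of group schemes cancel
(★ `IsBaseChangeVia.exists_comp_eq_of_comp`, ★ `isBaseChangeVia_of_comp`). [cite: GortzWedhorn2020, Prop. 4.16 (p. 101)]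
[cite: MumfordFogartyKirwan1994, Ch. 7 §2 Definition 7.2 (p. 129)] -/
theorem exists_overlapTransition (i j : 𝒰.I₀) :
    ∃ m : (A.overlapFamily 𝒰 i j).X.left ⟶ (A.overlapFamily 𝒰 j i).X.left,
      (A.overlapFamily 𝒰 i j).IsBaseChangeVia (A.overlapFamily 𝒰 j i) (pullbackSymmetry (𝒰.f i) (𝒰.f j)).hom m ∧
      m ≫ (pullback.fst (A.baseChange (𝒰.f j)).X.hom (pullback.fst (𝒰.f j) (𝒰.f i)) ≫ pullback.fst A.X.hom (𝒰.f j)) =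
        pullback.fst (A.baseChange (𝒰.f i)).X.hom (pullback.fst (𝒰.f i) (𝒰.f j)) ≫ pullback.fst A.X.hom (𝒰.f i) := by
  obtain ⟨m, hmG, hmπ⟩ := IsBaseChangeVia.exists_comp_eq_of_comp (A.overlapFamily_isBaseChangeVia_flip 𝒰 i j)
    (A.overlapFamily_isBaseChangeVia 𝒰 j i)
  exact ⟨m, isBaseChangeVia_of_comp (A.overlapFamily_isBaseChangeVia_flip 𝒰 i j) (A.overlapFamily_isBaseChangeVia 𝒰 j i)
    m hmG hmπ, hmG⟩

/-- **The transition `Aᵢ|_{V(i,j)} → Aⱼ|_{V(j,i)}` of the restricted chart families** (a choice from `exists_overlapTransition`;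
it is unique, `overlapTransition_unique`). [cite: MumfordFogartyKirwan1994, Ch. 7 §2 Definition 7.2 (p. 129)] -/
def overlapTransition (i j : 𝒰.I₀) : (A.overlapFamily 𝒰 i j).X.left ⟶ (A.overlapFamily 𝒰 j i).X.left :=
  (A.exists_overlapTransition 𝒰 i j).choose

/-- The transition is a base change of GROUP schemes along the flip. [cite: MumfordFogartyKirwan1994, Ch. 7 §2 Definition 7.2 (p. 129)] -/
theorem overlapTransition_isBaseChangeVia (i j : 𝒰.I₀) :
    (A.overlapFamily 𝒰 i j).IsBaseChangeVia (A.overlapFamily 𝒰 j i) (pullbackSymmetry (𝒰.f i) (𝒰.f j)).hom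
      (A.overlapTransition 𝒰 i j) :=
  (A.exists_overlapTransition 𝒰 i j).choose_spec.1

/-- The transition commutes with the projections to `A`. [cite: MumfordFogartyKirwan1994, Ch. 7 §2 Definition 7.2 (p. 129)] -/
@[reassoc]
theorem overlapTransition_comp_fst_fst (i j : 𝒰.I₀) :
    A.overlapTransition 𝒰 i j ≫
        (pullback.fst (A.baseChange (𝒰.f j)).X.hom (pullback.fst (𝒰.f j) (𝒰.f i)) ≫ pullback.fst A.X.hom (𝒰.f j)) =
      pullback.fst (A.baseChange (𝒰.f i)).X.hom (pullback.fst (𝒰.f i) (𝒰.f j)) ≫ pullback.fst A.X.hom (𝒰.f i) :=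
  (A.exists_overlapTransition 𝒰 i j).choose_spec.2

/-- The transition lies over the flip: `m ≫ π = π ≫ flip`. [cite: MumfordFogartyKirwan1994, Ch. 7 §2 Definition 7.2 (p. 129)] -/
@[reassoc]
theorem overlapTransition_comp_hom (i j : 𝒰.I₀) :
    A.overlapTransition 𝒰 i j ≫ (A.overlapFamily 𝒰 j i).X.hom =
      (A.overlapFamily 𝒰 i j).X.hom ≫ (pullbackSymmetry (𝒰.f i) (𝒰.f j)).hom := by
  obtain ⟨w, -, -, -⟩ := A.overlapTransition_isBaseChangeVia 𝒰 i j
  exact w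

/-- **Uniqueness of the transition**: a map `Aᵢ|_{V(i,j)} → Aⱼ|_{V(j,i)}` over the flip commuting with the projections to `A`
IS `overlapTransition i j` (★ `IsBaseChangeVia.comp_eq_unique`). [cite: GortzWedhorn2020, Prop. 4.16 (p. 101)] -/
theorem overlapTransition_unique (i j : 𝒰.I₀) (m : (A.overlapFamily 𝒰 i j).X.left ⟶ (A.overlapFamily 𝒰 j i).X.left)
    (hmG : m ≫ (pullback.fst (A.baseChange (𝒰.f j)).X.hom (pullback.fst (𝒰.f j) (𝒰.f i)) ≫ pullback.fst A.X.hom (𝒰.f j)) =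
      pullback.fst (A.baseChange (𝒰.f i)).X.hom (pullback.fst (𝒰.f i) (𝒰.f j)) ≫ pullback.fst A.X.hom (𝒰.f i))
    (hmπ : m ≫ (A.overlapFamily 𝒰 j i).X.hom = (A.overlapFamily 𝒰 i j).X.hom ≫ (pullbackSymmetry (𝒰.f i) (𝒰.f j)).hom) :
    m = A.overlapTransition 𝒰 i j :=
  IsBaseChangeVia.comp_eq_unique (A.overlapFamily_isBaseChangeVia 𝒰 j i) hmG hmπ
    (A.overlapTransition_comp_fst_fst 𝒰 i j) (A.overlapTransition_comp_hom 𝒰 i j)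

/-- The flip of the self-overlap `V(i,i) = Uᵢ ×_S Uᵢ` is the identity (`Uᵢ → S` is a monomorphism, so `pr₁ = pr₂`; this is the
`t_id` field of Mathlib's `𝒰.gluedCover`). [cite: StacksProject, Tag 01JA] -/
theorem pullbackSymmetry_self_hom_eq_id (i : 𝒰.I₀) : (pullbackSymmetry (𝒰.f i) (𝒰.f i)).hom = 𝟙 _ := by
  apply pullback.hom_ext
  · rw [pullbackSymmetry_hom_comp_fst, Category.id_comp, fst_eq_snd_of_mono_eq]
  · rw [pullbackSymmetry_hom_comp_snd, Category.id_comp, fst_eq_snd_of_mono_eq]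

/-- **`overlapTransition i i = 𝟙`** (uniqueness, the flip of `V(i,i)` being the identity). [cite: StacksProject, Tag 01LH] -/
theorem overlapTransition_self (i : 𝒰.I₀) : A.overlapTransition 𝒰 i i = 𝟙 _ :=
  (A.overlapTransition_unique 𝒰 i i (𝟙 _) (Category.id_comp _)
    (by rw [Category.id_comp, pullbackSymmetry_self_hom_eq_id 𝒰 i, Category.comp_id])).symm

/-- The dual transport along the IDENTITY square `(𝟙, 𝟙)` of a dual pair to itself is the identity (uniqueness ★
`eq_hatTransportOfBaseChange_of_nonempty_pullback_map_iso` with `Ĝ₁ := 𝟙`: `(𝟙 × 𝟙)^*𝒫 = 𝒫`).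
[cite: MilneAV2008, I §8 pp. 36–37] -/
theorem hatTransportOfBaseChange_refl_eq_id {T : Scheme.{u}} {B : AbelianSchemeOver T} (E : B.DualPair) :
    DualPair.hatTransportOfBaseChange E E (IsBaseChangeVia.refl B) = 𝟙 _ := by
  symm
  refine DualPair.eq_hatTransportOfBaseChange_of_nonempty_pullback_map_iso E E (IsBaseChangeVia.refl B) (𝟙 _)
    (by rw [Category.id_comp, Category.comp_id]) (by rw [Category.id_comp, Category.comp_id]) ?_
  have hmap : pullback.map B.X.hom E.hat.X.hom B.X.hom E.hat.X.hom (𝟙 _) (𝟙 _) (𝟙 T)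
      (by rw [Category.id_comp, Category.comp_id]) (by rw [Category.id_comp, Category.comp_id]) = 𝟙 _ := by
    apply pullback.hom_ext <;> simp only [pullback.lift_fst, pullback.lift_snd, Category.id_comp, Category.comp_id]
  exact ⟨(Scheme.Modules.pullbackCongr hmap).app E.P ≪≫ (Scheme.Modules.pullbackId _).app E.P⟩

/-! ### §2 Normalised chart duals and the transition of the hats -/

section Hat

variable [IsLocallyNoetherian S] (D : ∀ i, (A.baseChange (𝒰.f i)).DualPair)

/-- The chart duals, hat-normalised (★ `DualPair.normalize`): same `Âᵢ`, Poincaré sheaf twisted so that `𝒫ᵢ|_{Aᵢ × {ε_{Âᵢ}}} ≅ 𝒪`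
(the cure of FINDING 8aea22b3 — with this normalisation every dual transport is a homomorphism). [cite: MumfordFogartyKirwan1994, Ch. 6 §2 (p. 121)]
[cite: MilneAV2008, I §8 pp. 36–37] -/
abbrev chartDual (i : 𝒰.I₀) : (A.baseChange (𝒰.f i)).DualPair := (D i).normalize

omit [IsLocallyNoetherian S] in
/-- The unit hypothesis `𝒫ᵢ|_{Aᵢ × {ε_{Âᵢ}}} ≅ 𝒪` of the normalised chart dual. [cite: MumfordFogartyKirwan1994, Ch. 6 §2 (p. 121)] -/
theorem nonempty_unitHatSlice_chartDual (i : 𝒰.I₀) :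
    Nonempty ((Scheme.Modules.pullback (DualPair.unitHatSlice (A.chartDual 𝒰 D i))).obj (A.chartDual 𝒰 D i).P ≅
      SheafOfModules.unit _) :=
  (D i).nonempty_unitHatSlice_iso_normalize

/-- The chart dual restricted to the double overlap `V(i,j)` (★ `DualPair.baseChange`): a dual pair of `Aᵢ|_{V(i,j)}` with hat
`Âᵢ ×_{Uᵢ} V(i,j)`. [cite: MumfordFogartyKirwan1994, Ch. 6 §1 Cor. 6.8 (p. 118)] -/
abbrev overlapDual (i j : 𝒰.I₀) : (A.overlapFamily 𝒰 i j).DualPair :=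
  (A.chartDual 𝒰 D i).baseChange (pullback.fst (𝒰.f i) (𝒰.f j))

/-- **THE TRANSITION OF THE HATS** `θᵢⱼ : Âᵢ ×_{Uᵢ} V(i,j) → Âⱼ ×_{Uⱼ} V(j,i)`: the dual transport (★ `DualPair.hatTransportOfBaseChange`,
[MumfordFogartyKirwan1994] remark after Def. 7.5 «`(X ×_S T)^ = X̂ ×_S T`») along the square `(overlapTransition i j, flip)` between
the restricted chart duals — the `θ` field of a ★ `CocycleDatum 𝒰.gluedCover` for the hats.
[cite: MumfordFogartyKirwan1994, Ch. 7 §2 remark after Definition 7.5 (p. 130)] [cite: MilneAV2008, I §8 pp. 36–37] -/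
def hatTransition (i j : 𝒰.I₀) :
    pullback (A.chartDual 𝒰 D i).hat.X.hom (pullback.fst (𝒰.f i) (𝒰.f j)) ⟶
      pullback (A.chartDual 𝒰 D j).hat.X.hom (pullback.fst (𝒰.f j) (𝒰.f i)) :=
  DualPair.hatTransportOfBaseChange (A.overlapDual 𝒰 D j i) (A.overlapDual 𝒰 D i j)
    (A.overlapTransition_isBaseChangeVia 𝒰 i j)

omit [IsLocallyNoetherian S] in
/-- `θᵢⱼ` lies over the flip: `θᵢⱼ ≫ π̂ⱼ| = π̂ᵢ| ≫ flip`. [cite: MumfordFogartyKirwan1994, Ch. 7 §2 Definition 7.2 (p. 129)] -/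
@[reassoc]
theorem hatTransition_comp_hom (i j : 𝒰.I₀) :
    A.hatTransition 𝒰 D i j ≫ (A.overlapDual 𝒰 D j i).hat.X.hom =
      (A.overlapDual 𝒰 D i j).hat.X.hom ≫ (pullbackSymmetry (𝒰.f i) (𝒰.f j)).hom :=
  DualPair.hatTransportOfBaseChange_comp_hom _ _ _

/-- **`θᵢⱼ` IS A BASE CHANGE OF GROUP SCHEMES ALONG THE FLIP** — the `hθ` field of ★ `CocycleDatum 𝒰.gluedCover` for the hats:
★ `hat_isBaseChangeVia_hatTransportOfBaseChange_of_isLocallyNoetherian_base` ([MumfordFogartyKirwan1994] Cor. 6.4 in Stein form,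
NO connectedness) over the locally Noetherian `V(i,j)` (an open of `S`), fed with the unit hypotheses of the NORMALISED chart
duals (★ `nonempty_unitHatSlice_baseChange_iso`). [cite: MumfordFogartyKirwan1994, Ch. 6 §1 Corollary 6.4 (p. 117) and Cor. 6.8 (p. 118)]
[cite: MilneAV2008, I §8 pp. 36–37] -/
theorem hatTransition_isBaseChangeVia (i j : 𝒰.I₀) :
    (A.overlapDual 𝒰 D i j).hat.IsBaseChangeVia (A.overlapDual 𝒰 D j i).hat (pullbackSymmetry (𝒰.f i) (𝒰.f j)).hom
      (A.hatTransition 𝒰 D i j) := by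
  haveI : IsLocallyNoetherian (pullback (𝒰.f i) (𝒰.f j)) :=
    isLocallyNoetherian_of_isOpenImmersion (pullback.fst (𝒰.f i) (𝒰.f j) ≫ 𝒰.f i)
  exact DualPair.hat_isBaseChangeVia_hatTransportOfBaseChange_of_isLocallyNoetherian_base _ _ _
    (DualPair.nonempty_unitHatSlice_baseChange_iso _ (A.nonempty_unitHatSlice_chartDual 𝒰 D j))
    (DualPair.nonempty_unitHatSlice_baseChange_iso _ (A.nonempty_unitHatSlice_chartDual 𝒰 D i))

omit [IsLocallyNoetherian S] in
/-- **THE POINCARÉ CLAUSE of the transition pair** `(overlapTransition i j, θᵢⱼ)`: `(m × θᵢⱼ)^* 𝒫ⱼ| ≅ 𝒫ᵢ|` (★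
`nonempty_pullback_map_hatTransportOfBaseChange_iso`). [cite: MumfordFogartyKirwan1994, Ch. 7 §2 Definition 7.3 (p. 129)] [cite: MilneAV2008, I §8 pp. 36–37] -/
theorem nonempty_pullback_map_hatTransition_iso (i j : 𝒰.I₀) :
    Nonempty ((Scheme.Modules.pullback
      (pullback.map (A.overlapFamily 𝒰 i j).X.hom (A.overlapDual 𝒰 D i j).hat.X.hom
        (A.overlapFamily 𝒰 j i).X.hom (A.overlapDual 𝒰 D j i).hat.X.hom
        (A.overlapTransition 𝒰 i j) (A.hatTransition 𝒰 D i j) (pullbackSymmetry (𝒰.f i) (𝒰.f j)).hom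
        (A.overlapTransition_comp_hom 𝒰 i j).symm (A.hatTransition_comp_hom 𝒰 D i j).symm)).obj (A.overlapDual 𝒰 D j i).P ≅
      (A.overlapDual 𝒰 D i j).P) :=
  DualPair.nonempty_pullback_map_hatTransportOfBaseChange_iso _ _ _ (A.overlapTransition_comp_hom 𝒰 i j).symm
    (A.hatTransition_comp_hom 𝒰 D i j).symm

/-! ### §3 `θᵢᵢ = 𝟙` -/

omit [IsLocallyNoetherian S] in
/-- **`θᵢᵢ = 𝟙`** — the `hθid` field of ★ `CocycleDatum 𝒰.gluedCover` for the hats: over `V(i,i)` the flip is `𝟙`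
(`pullbackSymmetry_self_hom_eq_id`) and `overlapTransition i i = 𝟙` (`overlapTransition_self`), so `θᵢᵢ` is the transport along the
identity square (★ `hatTransportOfBaseChange_congr`), i.e. `𝟙` (`hatTransportOfBaseChange_refl_eq_id`). [cite: StacksProject, Tag 01LH]
[cite: MilneAV2008, I §8 pp. 36–37] -/
theorem hatTransition_self (i : 𝒰.I₀) : A.hatTransition 𝒰 D i i = 𝟙 _ := by
  unfold hatTransition
  rw [DualPair.hatTransportOfBaseChange_congr (A.overlapDual 𝒰 D i i) (A.overlapDual 𝒰 D i i)
    (A.overlapTransition_isBaseChangeVia 𝒰 i i) (pullbackSymmetry_self_hom_eq_id 𝒰 i) (A.overlapTransition_self 𝒰 i)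
    (IsBaseChangeVia.refl _)]
  exact hatTransportOfBaseChange_refl_eq_id (A.overlapDual 𝒰 D i i)

/-! ### §4 The cocycle datum and the glued hat, given the cocycle identity -/

/-- **THE `CocycleDatum` OF THE HATS over `𝒰.gluedCover`**, GIVEN the cocycle identity `hcoc` on triple overlaps (★ `relativeT'`
currency; road (H4): ★ `AbelianSchemeOverGlueDataTripleCocycle` template with ★ `DualPair.eq_of_nonempty_iso` as rigidity input):
charts `Âᵢ`, transitions `θᵢⱼ` (`hatTransition`), `hθ` = `hatTransition_isBaseChangeVia`, `hθid` = `hatTransition_self`.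
[cite: StacksProject, Tag 01LH] [cite: MumfordFogartyKirwan1994, Ch. 6 §1 Cor. 6.8 (p. 118)] -/
def hatCocycleDatum
    (hcoc : ∀ i j k,
      Morphisms.relativeT' 𝒰.gluedCover (fun i => (A.chartDual 𝒰 D i).hat.X.left) (fun i => (A.chartDual 𝒰 D i).hat.X.hom)
          (A.hatTransition 𝒰 D) (fun i j => (A.hatTransition_isBaseChangeVia 𝒰 D i j).fst) i j k ≫
        Morphisms.relativeT' 𝒰.gluedCover (fun i => (A.chartDual 𝒰 D i).hat.X.left) (fun i => (A.chartDual 𝒰 D i).hat.X.hom)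
          (A.hatTransition 𝒰 D) (fun i j => (A.hatTransition_isBaseChangeVia 𝒰 D i j).fst) j k i ≫
        Morphisms.relativeT' 𝒰.gluedCover (fun i => (A.chartDual 𝒰 D i).hat.X.left) (fun i => (A.chartDual 𝒰 D i).hat.X.hom)
          (A.hatTransition 𝒰 D) (fun i j => (A.hatTransition_isBaseChangeVia 𝒰 D i j).fst) k i j = 𝟙 _) :
    CocycleDatum 𝒰.gluedCover where
  A i := (A.chartDual 𝒰 D i).hat
  θ := A.hatTransition 𝒰 D
  hθ := A.hatTransition_isBaseChangeVia 𝒰 D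
  hθid := A.hatTransition_self 𝒰 D
  hcoc := hcoc

/-- **THE GLUED HAT `Â⁰ → ⋃ Uᵢ`** (over Mathlib's `𝒰.gluedCover.glued ≅ S`), given the cocycle identity: ★ `CocycleDatum.abelianScheme`.
[cite: StacksProject, Tag 01LH] [cite: MumfordFogartyKirwan1994, Ch. 6 §1 Cor. 6.8 (p. 118)] -/
def gluedHat
    (hcoc : ∀ i j k,
      Morphisms.relativeT' 𝒰.gluedCover (fun i => (A.chartDual 𝒰 D i).hat.X.left) (fun i => (A.chartDual 𝒰 D i).hat.X.hom)
          (A.hatTransition 𝒰 D) (fun i j => (A.hatTransition_isBaseChangeVia 𝒰 D i j).fst) i j k ≫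
        Morphisms.relativeT' 𝒰.gluedCover (fun i => (A.chartDual 𝒰 D i).hat.X.left) (fun i => (A.chartDual 𝒰 D i).hat.X.hom)
          (A.hatTransition 𝒰 D) (fun i j => (A.hatTransition_isBaseChangeVia 𝒰 D i j).fst) j k i ≫
        Morphisms.relativeT' 𝒰.gluedCover (fun i => (A.chartDual 𝒰 D i).hat.X.left) (fun i => (A.chartDual 𝒰 D i).hat.X.hom)
          (A.hatTransition 𝒰 D) (fun i j => (A.hatTransition_isBaseChangeVia 𝒰 D i j).fst) k i j = 𝟙 _) :
    AbelianSchemeOver 𝒰.gluedCover.glued :=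
  (A.hatCocycleDatum 𝒰 D hcoc).abelianScheme

/-- **The charts of the glued hat are CARTESIAN, as group schemes**: `Âᵢ → Â⁰` over `Uᵢ → ⋃ Uᵢ` is a base change (★
`CocycleDatum.isBaseChangeVia_abelianScheme`). [cite: StacksProject, Tag 01LH] [cite: MumfordFogartyKirwan1994, Ch. 7 §2 Definition 7.2 (p. 129)] -/
theorem isBaseChangeVia_gluedHat
    (hcoc : ∀ i j k,
      Morphisms.relativeT' 𝒰.gluedCover (fun i => (A.chartDual 𝒰 D i).hat.X.left) (fun i => (A.chartDual 𝒰 D i).hat.X.hom)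
          (A.hatTransition 𝒰 D) (fun i j => (A.hatTransition_isBaseChangeVia 𝒰 D i j).fst) i j k ≫
        Morphisms.relativeT' 𝒰.gluedCover (fun i => (A.chartDual 𝒰 D i).hat.X.left) (fun i => (A.chartDual 𝒰 D i).hat.X.hom)
          (A.hatTransition 𝒰 D) (fun i j => (A.hatTransition_isBaseChangeVia 𝒰 D i j).fst) j k i ≫
        Morphisms.relativeT' 𝒰.gluedCover (fun i => (A.chartDual 𝒰 D i).hat.X.left) (fun i => (A.chartDual 𝒰 D i).hat.X.hom)
          (A.hatTransition 𝒰 D) (fun i j => (A.hatTransition_isBaseChangeVia 𝒰 D i j).fst) k i j = 𝟙 _)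
    (i : 𝒰.I₀) :
    (A.chartDual 𝒰 D i).hat.IsBaseChangeVia (A.gluedHat 𝒰 D hcoc) (𝒰.gluedCover.ι i)
      ((A.hatCocycleDatum 𝒰 D hcoc).total.ι i) :=
  (A.hatCocycleDatum 𝒰 D hcoc).isBaseChangeVia_abelianScheme i

end Hat

end AbelianSchemeOver

end Literature.AlgebraicGeometry.AbelianSchemes

end
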